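import Literature.MathematicalPhysics.QuantumLattice.HartreeFockSDWTorus
import Literature.MathematicalPhysics.QuantumLattice.HubbardNNNHopping
import HarnessLib

/-!
# Hartree–Fock (Slater-determinant) upper bounds from NON-orthonormal orbitals: the Gram projector

Topic `MathematicalPhysics/QuantumLattice`, family `hubbard`; continuation of
`HartreeFockUpperBound.lean` (`HartreeFock.groundEnergyAt_le_hfEnergy`: `E₀(N) ≤ re E_HF(P)` for every
orthogonal projection `P` with `tr P = N`, Bach–Lieb–Solovej, J. Stat. Phys. 76 (1994) 3, eq. (2c.36))
and of `HartreeFockSDWTorus.lean` (`spinBlock`, `hfEnergy_spinBlock`: the functional of a collinear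
state). Those theorems take the one-particle density matrix `P` as an orthogonal projection. A
CERTIFICATE, however, naturally carries ORBITALS with rational (dyadic) entries, and rational orbitals
are essentially never orthonormal. The classical remedy (Löwdin, Phys. Rev. 97 (1955) 1474: density
matrices of a single determinant of non-orthogonal orbitals via the inverse overlap matrix) is the
**Gram projector**

  `P_A = A (Aᴴ A)⁻¹ Aᴴ`     (`A : Λ × N` the orbital matrix, `Aᴴ A` its Gram / overlap matrix),

which for linearly independent columns (`det (Aᴴ A) ≠ 0`) is the orthogonal projection onto their
span, i.e. the one-particle density matrix of their Slater determinant, WITHOUT any square root or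
orthonormalisation — so it stays inside `ℚ` when `A` is rational. We prove, by pure matrix algebra,

* `gramProjector_isHermitian`, `gramProjector_mul_self` (`P_A² = P_A`), `trace_gramProjector`
  (`tr P_A = N`) under `IsUnit (Aᴴ A).det` (Ben-Israel–Greville: Penrose equations, MacDuffee's
  full-rank formula `A† = (AᴴA)⁻¹Aᴴ`, `A A† = P_{R(A)}`, `rank = trace` for idempotents);
* the collinear two-species state `gramSpinState A₀ A₁ = spinBlock (P_{A₀}, P_{A₁})` is an orthogonal
  projection of trace `N₀ + N₁` (`isHermitian_gramSpinState`, `gramSpinState_mul_self`,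
  `trace_gramSpinState`);
* **`groundEnergyAt_le_hfEnergy_gram`**: on ANY finite graph `G`, for all real `t, U` and all orbital
  matrices `A₀ : Λ × N₀`, `A₁ : Λ × N₁` with invertible Gram matrices,
  `E₀(N₀ + N₁) ≤ re [ tr(K₋ₜ P_{A₀}) + tr(K₋ₜ P_{A₁}) + U Σ_x P_{A₀}(x,x) P_{A₁}(x,x) ]`
  (`K₋ₜ = hopMatrix G (-t)`), BLS94 (2c.36) for the unrestricted-Hartree–Fock / Slater state of the
  two orbital families;
* **`groundEnergy_hubbardRectTorusTT'_le_hfEnergy`** and **`..._le_hfEnergy_gram`**: the same bound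
  for the `t–t'` model of `HubbardNNNHopping.lean` on the rectangular torus
  (`hubbardRectTorusTT' a b t t' U = hamiltonian G_nn t U + hamiltonian G_diag t' 0`): the quasi-free
  state functional is linear, so `E₀(N) ≤ re [E_HF^{nn}(P) + E_HF^{diag, U=0}(P)]`.

These are the soundness statements behind exact-rational variational certificates of the form
"integer orbital matrices `A_↑, A_↓` ⇒ `E₀ ≤ E_HF(P_{A_↑}, P_{A_↓}) ∈ ℚ`" (cell pub-hubbard,
`certs/upper/FORMAT.md`, type `hub-recttorus-slater-upper`); the residual non-kernel step of such a
certificate is only the exact evaluation of the right-hand side.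

Everything is proved; definitions have bodies; no named facts.

## Mathlib / tree search

Tree (REUSED): `HartreeFock.groundEnergyAt_le_hfEnergy`, `HartreeFock.groundEnergy_le_re_groundStateFunctional`,
`HartreeFock.groundStateFunctional_hamiltonian`, `HartreeFock.hfEnergy`, `HartreeFock.spinBlock`,
`HartreeFock.conjTranspose_spinBlock`, `HartreeFock.spinBlock_mul_spinBlock`, `HartreeFock.trace_spinBlock`,
`HartreeFock.hfEnergy_spinBlock`, `LangerMattis.hopMatrix`, `hubbardRectTorusTT'`, `groundEnergyAt`.
Mathlib: `Matrix.isHermitian_conjTranspose_mul_self`, `Matrix.IsHermitian.inv`,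
`Matrix.isHermitian_mul_mul_conjTranspose`, `Matrix.nonsing_inv_mul`, `Matrix.mul_nonsing_inv`,
`Matrix.trace_mul_comm`, `Matrix.trace_one`, `Fintype.card_fin`, `Fin.sum_univ_two`.
`lean search 'gramProjector|Gram projector|nonorthogonal Slater|Lowdin'`: nothing in Mathlib or the tree
(Mathlib has `Matrix.toEuclideanLin`/`orthogonalProjection` on subspaces, not this closed matrix form
with its trace/idempotency lemmas over a general `RCLike` matrix).

## References

* V. Bach, E. H. Lieb, J. P. Solovej, J. Stat. Phys. 76 (1994) 3, eqs. (2c.8), (2c.36). [BachLiebSolovej1994]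
* A. Ben-Israel, T. N. E. Greville, Generalized Inverses: Theory and Applications, 2nd ed., CMS Books
  in Mathematics 15, Springer (2003): Ch. 1 §1 eqs. (1)–(4) (Penrose equations), Ch. 1 §6 Thm 5
  (MacDuffee) eq. (17), Ch. 2 §4 Lemma 1(c), Ch. 2 Ex. 58 (`A A† = P_{R(A)}`). [BenIsraelGreville2003]
* P.-O. Löwdin, Phys. Rev. 97 (1955) 1474 (non-orthogonal orbitals, inverse overlap matrix; context only).
* J. P. F. LeBlanc et al., PRX 5 (2015) 041041, eq. (1); H. Xu et al., Science 384 (2024) eadh7691,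
  eq. (1) (the `t–t'` model). [LeBlancEtAl2015] [XuEtAl2024]
-/

noncomputable section

namespace Literature.MathematicalPhysics.QuantumLattice

namespace HartreeFock

open Matrix Finset Literature.MathematicalPhysics.QuantumLattice.LangerMattis
open scoped ComplexConjugate ComplexOrder

/-! ### The Gram projector of an orbital matrix -/

section Gram

variable {Λ : Type*} [Fintype Λ] {N : ℕ}

/-- The **Gram projector** of an orbital matrix `A : Λ × N` (columns = orbitals):
`P_A = A (Aᴴ A)⁻¹ Aᴴ`. For linearly independent columns (`A` of full column rank) the
Moore–Penrose inverse is `A† = (AᴴA)⁻¹Aᴴ` (MacDuffee's formula with the trivial full-rank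
factorisation `A = A · 1`), so `P_A = A A†` is the orthogonal projector onto the column span
(Ben-Israel–Greville, Ch. 2, Ex. 58: `A A† = P_{R(A)}`) — in quantum chemistry the one-particle
density matrix of the Slater determinant of the (non-orthogonal) columns (Löwdin 1955, inverse-overlap
form). For dependent columns `(Aᴴ A)⁻¹ = 0` (Mathlib's `nonsing_inv`) and `P_A = 0`.
[cite: BenIsraelGreville2003, Ch. 1, Thm 5 (MacDuffee), eq. (17)] -/
def gramProjector (A : Matrix Λ (Fin N) ℂ) : Matrix Λ Λ ℂ := A * (Aᴴ * A)⁻¹ * Aᴴ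

/-- The Gram projector is Hermitian (for every `A`; Penrose equation (3) `(AX)ᴴ = AX` for
`X = A†`). [cite: BenIsraelGreville2003, Ch. 1, §1, eq. (3)] -/
theorem gramProjector_isHermitian (A : Matrix Λ (Fin N) ℂ) : (gramProjector A).IsHermitian := by
  unfold gramProjector
  exact isHermitian_mul_mul_conjTranspose A (isHermitian_conjTranspose_mul_self A).inv

/-- The Gram projector is idempotent when the Gram matrix is invertible:
`P_A² = A (AᴴA)⁻¹ (AᴴA) (AᴴA)⁻¹ Aᴴ = P_A` (`A A† = P_{R(A)}` is a projector).
[cite: BenIsraelGreville2003, Ch. 2, Ex. 58] -/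
theorem gramProjector_mul_self (A : Matrix Λ (Fin N) ℂ) (hA : IsUnit (Aᴴ * A).det) :
    gramProjector A * gramProjector A = gramProjector A := by
  unfold gramProjector
  calc A * (Aᴴ * A)⁻¹ * Aᴴ * (A * (Aᴴ * A)⁻¹ * Aᴴ)
      = A * ((Aᴴ * A)⁻¹ * (Aᴴ * A)) * ((Aᴴ * A)⁻¹ * Aᴴ) := by
        simp only [Matrix.mul_assoc]
    _ = A * (Aᴴ * A)⁻¹ * Aᴴ := by
        rw [Matrix.nonsing_inv_mul _ hA, Matrix.mul_one, Matrix.mul_assoc]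

/-- The Gram projector has trace `N` (the number of orbitals) when the Gram matrix is invertible:
`tr (A (AᴴA)⁻¹ Aᴴ) = tr ((AᴴA)(AᴴA)⁻¹) = tr 1_N = N` (trace of an idempotent = its rank, here the
full column rank `N`). [cite: BenIsraelGreville2003, Ch. 2, §4, Lemma 1(c)] -/
theorem trace_gramProjector (A : Matrix Λ (Fin N) ℂ) (hA : IsUnit (Aᴴ * A).det) :
    (gramProjector A).trace = N := by
  unfold gramProjector
  rw [Matrix.trace_mul_comm, ← Matrix.mul_assoc, Matrix.mul_nonsing_inv _ hA,
    Matrix.trace_one, Fintype.card_fin]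

end Gram

/-! ### The collinear (unrestricted Hartree–Fock) state of two orbital families -/

section SpinState

variable {Λ : Type*} [Fintype Λ] {N₀ N₁ : ℕ}

/-- The collinear Slater / unrestricted-Hartree–Fock one-particle density matrix on
`Orb Λ = Λ × {↑,↓}` built from an `↑`-orbital matrix `A₀` and a `↓`-orbital matrix `A₁`:
`spinBlock (P_{A₀}, P_{A₁})`. [cite: BachLiebSolovej1994, eq. (3a.2)] -/
def gramSpinState (A₀ : Matrix Λ (Fin N₀) ℂ) (A₁ : Matrix Λ (Fin N₁) ℂ) :
    Matrix (Orb Λ) (Orb Λ) ℂ :=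
  spinBlock ![gramProjector A₀, gramProjector A₁]

/-- `gramSpinState` is Hermitian (a one-particle density matrix). [cite: BachLiebSolovej1994, Thm 2.3] -/
theorem isHermitian_gramSpinState (A₀ : Matrix Λ (Fin N₀) ℂ) (A₁ : Matrix Λ (Fin N₁) ℂ) :
    (gramSpinState A₀ A₁).IsHermitian := by
  rw [Matrix.IsHermitian, gramSpinState, conjTranspose_spinBlock]
  congr 1
  funext σ
  fin_cases σ
  · exact (gramProjector_isHermitian A₀).eq
  · exact (gramProjector_isHermitian A₁).eq

/-- `gramSpinState` is idempotent when both Gram matrices are invertible (the one-particle density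
matrix of a Slater determinant is a projection). [cite: BachLiebSolovej1994, Thm 2.3] -/
theorem gramSpinState_mul_self (A₀ : Matrix Λ (Fin N₀) ℂ) (A₁ : Matrix Λ (Fin N₁) ℂ)
    (h₀ : IsUnit (A₀ᴴ * A₀).det) (h₁ : IsUnit (A₁ᴴ * A₁).det) :
    gramSpinState A₀ A₁ * gramSpinState A₀ A₁ = gramSpinState A₀ A₁ := by
  rw [gramSpinState, spinBlock_mul_spinBlock]
  congr 1
  funext σ
  fin_cases σ
  · exact gramProjector_mul_self A₀ h₀
  · exact gramProjector_mul_self A₁ h₁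

/-- `tr (gramSpinState A₀ A₁) = N₀ + N₁` when both Gram matrices are invertible (particle number of
the Slater determinant). [cite: BachLiebSolovej1994, Thm 2.3] -/
theorem trace_gramSpinState (A₀ : Matrix Λ (Fin N₀) ℂ) (A₁ : Matrix Λ (Fin N₁) ℂ)
    (h₀ : IsUnit (A₀ᴴ * A₀).det) (h₁ : IsUnit (A₁ᴴ * A₁).det) :
    (gramSpinState A₀ A₁).trace = ((N₀ + N₁ : ℕ) : ℂ) := by
  rw [gramSpinState, trace_spinBlock, Fin.sum_univ_two]
  simp only [Matrix.cons_val_zero, Matrix.cons_val_one, trace_gramProjector A₀ h₀,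
    trace_gramProjector A₁ h₁, Nat.cast_add]

/-- The Hartree–Fock functional of `gramSpinState A₀ A₁` on a graph `G`:
`E_HF = tr(K₋ₜ P_{A₀}) + tr(K₋ₜ P_{A₁}) + U Σ_x P_{A₀}(x,x) P_{A₁}(x,x)` (kinetic + direct term; no
exchange term for a collinear state). [cite: BachLiebSolovej1994, eq. (2c.8)] -/
theorem hfEnergy_gramSpinState (G : SimpleGraph Λ) [DecidableRel G.Adj] (t U : ℝ)
    (A₀ : Matrix Λ (Fin N₀) ℂ) (A₁ : Matrix Λ (Fin N₁) ℂ) :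
    hfEnergy G t U (gramSpinState A₀ A₁) =
      (hopMatrix G (-t) * gramProjector A₀).trace + (hopMatrix G (-t) * gramProjector A₁).trace +
        (U : ℂ) * ∑ x, gramProjector A₀ x x * gramProjector A₁ x x := by
  rw [gramSpinState, hfEnergy_spinBlock, Fin.sum_univ_two]
  simp only [Matrix.cons_val_zero, Matrix.cons_val_one]

/-- **Slater-determinant (unrestricted Hartree–Fock) upper bound from non-orthonormal orbitals.**
On any finite graph `G`, for all real `t, U` and all orbital matrices `A₀ : Λ × N₀` (spin `↑`),
`A₁ : Λ × N₁` (spin `↓`) with invertible Gram matrices `A₀ᴴA₀`, `A₁ᴴA₁`: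
`E₀(N₀ + N₁) ≤ re [ tr(K₋ₜ P_{A₀}) + tr(K₋ₜ P_{A₁}) + U Σ_x P_{A₀}(x,x) P_{A₁}(x,x) ]`,
`P_A = A (AᴴA)⁻¹ Aᴴ`, `K₋ₜ = hopMatrix G (-t)`. This is BLS94 (2c.36) for the Slater determinant of
the `N₀ + N₁` spin-orbitals `(columns of A₀) ⊗ ↑`, `(columns of A₁) ⊗ ↓`, written so that rational
orbitals give a rational right-hand side. [cite: BachLiebSolovej1994, eq. (2c.36)] -/
theorem groundEnergyAt_le_hfEnergy_gram [LinearOrder Λ] (G : SimpleGraph Λ) [DecidableRel G.Adj]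
    (t U : ℝ)
    (A₀ : Matrix Λ (Fin N₀) ℂ) (A₁ : Matrix Λ (Fin N₁) ℂ)
    (h₀ : IsUnit (A₀ᴴ * A₀).det) (h₁ : IsUnit (A₁ᴴ * A₁).det) :
    groundEnergyAt G t U (N₀ + N₁) ≤
      ((hopMatrix G (-t) * gramProjector A₀).trace + (hopMatrix G (-t) * gramProjector A₁).trace +
        (U : ℂ) * ∑ x, gramProjector A₀ x x * gramProjector A₁ x x).re := by
  have h := groundEnergyAt_le_hfEnergy G t U (isHermitian_gramSpinState A₀ A₁)
    (gramSpinState_mul_self A₀ A₁ h₀ h₁) (trace_gramSpinState A₀ A₁ h₀ h₁)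
  rwa [hfEnergy_gramSpinState] at h

end SpinState

/-! ### The `t–t'` model on the rectangular torus -/

section TPrime

/-- **Hartree–Fock upper bound for the `t–t'` Hubbard model on the rectangular torus.** For every
orthogonal projection `P` on the one-particle space with `tr P = N`,
`E₀(H(t,t',U), N) ≤ re [ E_HF^{G_nn}(t, U; P) + E_HF^{G_diag}(t', 0; P) ]`: the quasi-free state
functional is linear and `hubbardRectTorusTT' = hamiltonian G_nn t U + hamiltonian G_diag t' 0`.
[cite: BachLiebSolovej1994, eq. (2c.36)] -/
theorem groundEnergy_hubbardRectTorusTT'_le_hfEnergy (a b : ℕ) (t t' U : ℝ)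
    {P : Matrix (Orb (Fin a ×ₗ Fin b)) (Orb (Fin a ×ₗ Fin b)) ℂ} (hP : P.IsHermitian)
    (hPP : P * P = P) {N : ℕ} (htr : P.trace = N) :
    groundEnergy (hubbardRectTorusTT' a b t t' U) N ≤
      (hfEnergy (fermionRectTorusGraph a b) t U P +
        hfEnergy (fermionRectTorusDiagGraph a b) t' 0 P).re := by
  have h := groundEnergy_le_re_groundStateFunctional hP hPP htr (hubbardRectTorusTT' a b t t' U)
  rwa [hubbardRectTorusTT', map_add, groundStateFunctional_hamiltonian _ hP hPP,
    groundStateFunctional_hamiltonian _ hP hPP] at h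

/-- **Slater upper bound for the `t–t'` model from non-orthonormal orbitals**: with
`P_σ = A_σ (A_σᴴ A_σ)⁻¹ A_σᴴ`,
`E₀(H(t,t',U), N₀+N₁) ≤ re [ Σ_σ tr(K^{nn}₋ₜ P_σ) + Σ_σ tr(K^{diag}₋ₜ' P_σ) + U Σ_x P_↑(x,x) P_↓(x,x) ]`.
[cite: BachLiebSolovej1994, eq. (2c.36)] -/
theorem groundEnergy_hubbardRectTorusTT'_le_hfEnergy_gram (a b : ℕ) (t t' U : ℝ) {N₀ N₁ : ℕ}
    (A₀ : Matrix (Fin a ×ₗ Fin b) (Fin N₀) ℂ) (A₁ : Matrix (Fin a ×ₗ Fin b) (Fin N₁) ℂ)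
    (h₀ : IsUnit (A₀ᴴ * A₀).det) (h₁ : IsUnit (A₁ᴴ * A₁).det) :
    groundEnergy (hubbardRectTorusTT' a b t t' U) (N₀ + N₁) ≤
      ((hopMatrix (fermionRectTorusGraph a b) (-t) * gramProjector A₀).trace +
          (hopMatrix (fermionRectTorusGraph a b) (-t) * gramProjector A₁).trace +
          (U : ℂ) * ∑ x, gramProjector A₀ x x * gramProjector A₁ x x +
        ((hopMatrix (fermionRectTorusDiagGraph a b) (-t') * gramProjector A₀).trace +
          (hopMatrix (fermionRectTorusDiagGraph a b) (-t') * gramProjector A₁).trace +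
          ((0 : ℝ) : ℂ) * ∑ x, gramProjector A₀ x x * gramProjector A₁ x x)).re := by
  have h := groundEnergy_hubbardRectTorusTT'_le_hfEnergy a b t t' U
    (isHermitian_gramSpinState A₀ A₁) (gramSpinState_mul_self A₀ A₁ h₀ h₁)
    (trace_gramSpinState A₀ A₁ h₀ h₁)
  rwa [hfEnergy_gramSpinState, hfEnergy_gramSpinState] at h

end TPrime

end HartreeFock

end Literature.MathematicalPhysics.QuantumLattice

end
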